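import Summits.BirchSwinnertonDyer.BirchSwinnertonDyer.Theses.AdditiveKolyvaginRoad
import Summits.BirchSwinnertonDyer.BirchSwinnertonDyer.Theorems.AdditiveKolyvaginRoadManinFrameTransport
import Summits.BirchSwinnertonDyer.BirchSwinnertonDyer.Theorems.AdditiveKolyvaginRoadManinFrameFromDatum
import Summits.BirchSwinnertonDyer.BirchSwinnertonDyer.Theorems.AdditiveKolyvaginRoadManinFrameResidueProperRTameTwistFull
import Summits.BirchSwinnertonDyer.BirchSwinnertonDyer.Theorems.AdditiveKolyvaginRoadManinFrameResidueProperRTameTwistFull57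
import Summits.BirchSwinnertonDyer.BirchSwinnertonDyer.Theorems.AdditiveKolyvaginRoadManinFrameResidueProperRTameTwistFull57LTwist
import HarnessLib

/-!
# Route `AdditiveKolyvaginRoad`, crux `ManinFrameResidueProperR` (stmt-BirchSwinnertonDyer-20709), line
# `tame_twist` (skeleton v3): the crux BY NAME from F″ and L-TWIST — CONDITIONAL composition (`--supports`)

Cell `pub/bsd-wall`, seat `bsd-wall-manin-p1` (g6). THEOREMS ONLY (no definition, no named fact, no `sorry`).
Nothing is closed unconditionally and BSD is not proved by this file.

The registered skeleton `Cruxes/ManinFrameResidueProperR/Lines/tame_twist.lean` (v3, seat g5, 818dc4eecd51ba5f)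
composes the crux from TWO stubs: F″ `stub_katoNeronFiveLe` (= the statement-only Literature fact
`kato_neron_isIntegral_twistedSymbolSum_of_additive_five_le`, Kato 2004 (8.1.3)/Thm 9.7/Thm 6.6 + Kim–Nakamura
2020 Cor. 2.4) and S57-T `stub_memberManinUnit_fiveSeven_torsion` (Manin's `p`-part, `p ∈ {5, 7}`, on the
Kosters–Pannekoek sub-residue). By `ManinFrameResidueProperRTameTwistLTwist.stub_memberManinUnit_fiveSeven_torsion_of_kato_of_lTwist`
(this seat, p590459; TORS-TWIST discharged by `TorsTwist.torsTwist`, p589688) S57-T follows from F″ and the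
twisted-period decomposition L-TWIST (`hLT`: `Λ(f) ⊆ s·Λ(f ⊗ χ_{q*}) + p·Λ(f)`, binder shape of p585596/p585934).
This file is the skeleton's composition `ManinFrameResidueProperR_of` with both stubs replaced:

  `maninFrameResidueProperR_of_kato_of_lTwist : F″ → L-TWIST → ManinFrameResidueProperR`.

So the crux is CONDITIONAL on F″ (published, statement-only) and L-TWIST (not yet in the tree; being derived in
cell `pub/bsd-wall` from the three-copy Ihara lemma of Darmon–Diamond–Taylor §4.5 and a Chebotarev-type
non-Eisenstein fact, seats `bsd-line-edix-p2/p3/p4`). Composition as in the skeleton: `p ≥ 11` → F″ ⟹ F′ ⟹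
the full tame-twist lever `exists_member_not_dvd_c_of_tameTwistL` (p573163); `p < 11` without a local-`p`-torsion
member → `stub_memberManinUnit_fiveSeven_of_kato57` (p579959); `p < 11` with such a member → S57-T from F″ and
L-TWIST; then prime-to-`p` transport (`ManinFrameTransport.exists_modularParametrizationData_not_dvd_of_partner`)
and the Hoffstein–Luo odd Heegner frame (`ManinFrameFromDatum.exists_oddHeegnerFrame_of_exists_not_dvd`).

References: [Kato2004Asterisque] (8.1.3), Thm. 9.7, Thm. 6.6; [KimNakamura2020] Cor. 2.4; [Stevens1989] §5;
[Ribet1984ICM] Thm. 4.1; [DarmonDiamondTaylor1995] §4.5; [SilvermanAEC2009] III.8.1, X.5 Cor. 5.4.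
-/

set_option autoImplicit false
-- the Theorems directory repeats the summit name (sibling precedent `SignedBaseChangeAssembly.lean`)
set_option linter.dupNamespace false

noncomputable section

open scoped Classical MatrixGroups

open WeierstrassCurve NumberField Literature.NumberTheory.EllipticCurves
  Literature.NumberTheory.EllipticCurves.ModularForms
  Literature.NumberTheory.EllipticCurves.Rank1Residual
  Literature.NumberTheory.DiophantineGeometry IsDedekindDomain Rat.HeightOneSpectrum
  Summit.BirchSwinnertonDyer.Rank1Residual Summit.BirchSwinnertonDyer.Rank1Residual.Additive
  Summit.BirchSwinnertonDyer.BirchSwinnertonDyer.Theorems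
  Summit.BirchSwinnertonDyer.BirchSwinnertonDyer.Theses.AdditiveKolyvaginRoad CongruenceSubgroup

namespace Summit.BirchSwinnertonDyer.BirchSwinnertonDyer.Theorems.ManinFrameResidueProperROfKatoLTwist

/-- **Crux `ManinFrameResidueProperR` (stmt-BirchSwinnertonDyer-20709) BY NAME, GRANTED F″ (`hK`) and L-TWIST
(`hLT`, the twisted-period decomposition in the binder shape of p585596/p585934).** The composition of the
registered skeleton v3 with its stub F″ replaced by the hypothesis `hK` and its stub S57-T by
`ManinFrameResidueProperRTameTwistLTwist.stub_memberManinUnit_fiveSeven_torsion_of_kato_of_lTwist hK hLT`.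
CONDITIONAL (F″ cite-only; L-TWIST not in the tree); the item is NOT closed by this; BSD is not proved by this.
[cite: Kato2004Asterisque, (8.1.3) (p. 180), Thm. 9.7 (p. 189)] [cite: KimNakamura2020, Cor. 2.4]
[cite: Stevens1989, Lemma (5.2) p. 96] [cite: SilvermanAEC2009, III.8.1, X.5 Cor. 5.4] -/
theorem maninFrameResidueProperR_of_kato_of_lTwist
    (hK : kato_neron_isIntegral_twistedSymbolSum_of_additive_five_le)
    (hLT : ∀ (p : ℕ) [Fact p.Prime] (q : ℕ) [Fact q.Prime] (V₀ : WeierstrassCurve ℚ) [V₀.IsElliptic]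
      [V₀.IsGloballyMinimal] [NeZero (V₀.conductorNorm ℤ)]
      (D₀ : ModularParametrizationData V₀ (V₀.conductorNorm ℤ)), 5 ≤ p → Irr V₀ p → q ≠ 2 → q ≠ p →
      ¬ q ∣ V₀.conductorNorm ℤ →
      ∀ (Vχ : WeierstrassCurve ℚ) [Vχ.IsElliptic] [Vχ.IsGloballyMinimal] (v : VariableChange ℚ),
      v • V₀.quadraticTwist (((-1 : ℤ) ^ (q / 2) * q : ℤ) : ℚ) = Vχ →
      ∀ (s : ℂ), s ^ 2 = (((-1 : ℤ) ^ (q / 2) * q : ℤ) : ℂ) →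
      ∀ (N' : ℕ) [NeZero N'] (g : CuspForm (Gamma0 N') 2), IsNewformOf Vχ g →
      ∀ z ∈ periodLattice D₀.f, ∃ w ∈ periodLattice g, ∃ y ∈ periodLattice D₀.f, z = s * w + (p : ℂ) * y) :
    ManinFrameResidueProperR := by
  intro _e1 _e2 dd hPub W _ _ p hp _ hp5 hadd hirr hres hall hr
  have hnf : exists_isNewformOf := hPub.2.2.2.2.2.1
  -- a member with a Manin-unit datum, by prime range and locus
  have hmem : ∃ (W₀ : WeierstrassCurve ℚ) (_ : W₀.IsElliptic) (_ : W₀.IsGloballyMinimal)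
      (D₀ : ModularParametrizationData W₀ (W.conductorNorm ℤ)),
      IsIsogenous W W₀ ∧ ¬ (p : ℤ) ∣ D₀.c := by
    rcases lt_or_ge p 11 with h11 | h11
    · by_cases hPT : ∀ (W' : WeierstrassCurve ℚ) (_ : W'.IsElliptic) (_ : W'.IsGloballyMinimal),
          IsIsogenous W W' → ∀ P : (W'.baseChange ℚ_[p]).toAffine.Point, p • P = 0 → P = 0
      · exact ManinFrameResidueProperRTameTwist.stub_memberManinUnit_fiveSeven_of_kato57 hK hnf W hp5 h11 hadd
          hirr hres hall (fun W' hE' hM' hiso P hP ↦ hPT W' hE' hM' hiso P hP)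
      · push Not at hPT
        obtain ⟨W', hE', hM', hiso, P, hP, hP0⟩ := hPT
        exact ManinFrameResidueProperRTameTwistLTwist.stub_memberManinUnit_fiveSeven_torsion_of_kato_of_lTwist hK
          hLT dd hnf W p hp5 h11 hadd hirr hres hall ⟨W', hE', hM', hiso, P, hP, hP0⟩
    · -- F″ ⟹ F′ (the `7 < p` clause of F″ is void), as in the skeleton's `katoNeron_of_fiveLe`
      exact ManinFrameResidueProperRTameTwist.exists_member_not_dvd_c_of_tameTwistL
        (fun V _ _ N _ f hf p _ h7 hg hm hi m _ hc χ hχp hχ1 hord ϖ r ↦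
          hK V f hf p (by omega) hg hm hi m hc (Or.inl h7) χ hχp hχ1 hord ϖ r) hnf W h11 hadd hirr
  obtain ⟨W₀, hE₀, hM₀, D₀, hiso, hc₀⟩ := hmem
  haveI := hE₀
  haveI := hM₀
  -- transport to a datum of `W` with `p ∤ c` (prime-to-`p` isogeny multiplier under Irr)
  obtain ⟨Dt, hc⟩ := ManinFrameTransport.exists_modularParametrizationData_not_dvd_of_partner W hp.out hirr hiso D₀ hc₀
  -- the Hoffstein–Luo odd Heegner frame
  have hp2 : p ≠ 2 := by omega
  exact ManinFrameFromDatum.exists_oddHeegnerFrame_of_exists_not_dvd hnf hPub.2.2.2.2.2.2.1 W p hr hp2 ⟨Dt, hc⟩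

end Summit.BirchSwinnertonDyer.BirchSwinnertonDyer.Theorems.ManinFrameResidueProperROfKatoLTwist

end
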